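import Literature.IUT.HodgeArakelov.CohomologyLimitComap
import Literature.IUT.HodgeArakelov.CohomologyLimitKummer

/-!
# Compatibility: the two packagings of the conjugation action on `lim_K H¹(H|_K, A)` as `Π →* MulAut` COINCIDE

DISCLOSURE / bookkeeping (abc-iut cell, layer L6, seat abc-iut-w4-d004 gen 2). Two files landed the SAME packaging of
abc-iut-w4-d043's conjugation action `h1LimConj` / `h1LimConjEquiv` ([IUTchII] Prop 3.1 (ii) p. 88 "equipped with a
natural conjugation action by `Π_X(M^Θ_*)`" [cite: Mochizuki2012, Prop 3.1 (ii) p.88]) as a homomorphism into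
`MulAut (Multiplicative (h1Lim φ A H ⊥))`: abc-iut-w4-d007's `CohomologySystemOfContH1.h1LimConjMulAut`
(`CohomologyLimitKummer.lean`, universe `0`) and abc-iut-w4-d004's `h1LimConjMulAut` (`CohomologyLimitComap.lean`,
universe-polymorphic; written before the former was in the tree). Different fully-qualified names, no kernel
clash; this file records that they are DEFINITIONALLY EQUAL (`rfl`), so consumers of either family
(`h1LimKummer_smul` on the Kummer side; `h1LimComap_conj` / the Cor 3.5 (ii) model files on the restriction side)
may be combined freely. Proof-only; nothing of [IUTchII] asserted; no side taken on [IUTchIII] Cor. 3.12.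
-/

namespace Literature.IUT.HodgeArakelov

open CohomologySystemOfContH1

variable {P : TopGroup.{0}} {G' : Type} [Group G'] [TopologicalSpace G'] [IsTopologicalGroup G']
  (φ : P →* G') (A : Subgroup G') [A.Normal] [IsMulCommutative A] (H : Subgroup P) [H.Normal]

/-- The two `MulAut` packagings of the conjugation action on the cohomology limit are the same homomorphism
(definitionally). [cite: Mochizuki2012, Prop 3.1 (ii) p.88] -/
theorem h1LimConjMulAut_eq_cohomologySystemOfContH1 :
    h1LimConjMulAut φ A H = CohomologySystemOfContH1.h1LimConjMulAut φ A H := rfl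

/-- … hence agree on every element. [cite: Mochizuki2012, Prop 3.1 (ii) p.88] -/
theorem h1LimConjMulAut_apply_eq (σ : P) (x : Multiplicative (h1Lim φ A H ⊥)) :
    h1LimConjMulAut φ A H σ x = CohomologySystemOfContH1.h1LimConjMulAut φ A H σ x := rfl

end Literature.IUT.HodgeArakelov
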